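import Summits.BirchSwinnertonDyer.Rank1Residual.Additive.RamifiedSevenGenusKatoExpDatum
import Summits.BirchSwinnertonDyer.Rank1Residual.Additive.RamifiedSevenGenusKSideRank
import Summits.BirchSwinnertonDyer.Rank1Residual.Additive.RamifiedSevenGenusHeckeTwistDictionary
import Summits.BirchSwinnertonDyer.Rank1Residual.Additive.RamifiedSevenGenusLayerCharacters
import Literature.NumberTheory.DiophantineGeometry.Conductor
import HarnessLib

set_option linter.dupNamespace false
set_option autoImplicit false

/-!
# K2C-10 FACTS JUNCTION: the five structural / analytic conjuncts (tf) (rk) (hχ) (hL) (r5′) of the K2ᶜ input form are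
# ONE TERM from {GZK, `𝒞₇` membership, Hecke 1920, Rohrlich 1988, a newform of `W`} at EVERY pinned frame — so the research
# stub `stub_integralComparisonInputsSeven` shrinks to «frame + Kato-exp datum + gauge + the exposed divisibility (KI)»
# (ideator bsd-idea-20 g74; crux `EllipticUnitValueSevenOfGZK` = stmt-BirchSwinnertonDyer-19945; row K2C-10 of pen D1013/D1018/D1019)

WHAT THIS FILE IS.  A crux workfile (published with `ledger crux write`, never a skeleton, never `skeleton check`ed; it touches
no registered line).  It composes — for the first time in the tree (`rg` over `lean/`: 0 Lean consumers of the five theorems below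
outside their own files, 2026-08-31T01:45Z) — the cell's FIVE landed per-frame discharges of the binders of zp v13–v16's input-form
stub `stub_integralComparisonInputsSeven` (`Cruxes/EllipticUnitValueSevenOfGZK/Lines/kato_perrin_riou_zp.lean` v16 bb91f352028468bc,
l.544–566; conjunct letters below are copied from there BYTE FOR BYTE):

* (tf)  `GenusSeven.PinnedKatoGenusFrame.tf_of_inputs hγ` — `Additive/RamifiedSevenGenusKSideRank.lean` l.293 (p783797), UNCONDITIONAL;
* (rk)  `GenusSeven.PinnedKatoGenusFrame.rk_of_inputs hGZK hC hγ` — ibid. l.358 (p783797), from GZK + `X12.ClassCSeven W`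
        (this also answers flag (F3) of `bsd-cm-prr-ty1/g33/CarrierColumn-scope.md` «K-side Thm 12.4 (2) has no tree theorem»: it has, in
        the letter of the stub's (rk) conjunct — as g72 `C4aValuesPin_g72.lean` l.35 already noted);
* (hχ)  `GenusSeven.PinnedKatoGenusFrame.hχ_of_inputs` — `Additive/RamifiedSevenGenusLayerCharacters.lean` l.57 (p782381), UNCONDITIONAL;
* (hL)  `GenusSeven.PinnedKatoGenusFrame.hL_of_inputs hHecke` — `Additive/RamifiedSevenGenusHeckeTwists.lean` l.110 (p784707), from the
        cite-tagged named fact `hecke1920_depletedHeckeL_entire` (`Literature/NumberTheory/LFunctions/DepletedHeckeLSeriesEntire.lean` l.60);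
* (r5′) `GenusSeven.PinnedKatoGenusFrame.r5'_of_facts hRo hC hf` — `Additive/RamifiedSevenGenusHeckeTwistDictionary.lean` l.277 (p789122),
        from the cite-tagged named fact `Rohrlich1988_nonvanishing_twists_anyLevel` (`Literature/NumberTheory/EllipticCurves/
        RohrlichNonvanishing.lean` l.113) and a newform `f` of `W` (`ModularForms.IsNewformOf W f`; globally: `ModularForms.exists_isNewformOf`
        = conjunct 2 of zp's `stub_printFactsKato`, instance `NeZero (W.conductorNorm ℤ)` from `conductorNorm_pos_holds`).

CONTENTS.
* §1 (DATUM-FREE, valid for v16's dead datum and v17's `KatoExpDatum` alike) `structuralInputs_of_facts` / `structuralInputs_of_mod`: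
  `(tf) ∧ (rk) ∧ (hχ) ∧ (hL) ∧ (r5′)` at every pinned frame `Φ` of a `𝒞₇` member, in the stub's letter.
* §2 (over the LANDED repaired datum `GenusSeven.KatoExpDatum hγ Φ`, (C6-R) 2/4 p800949, commit 4cd6afb874e7) `inputsAt_of_facts`: the
  whole per-frame body `∃ D, ∃ t′ m₀, (ht′) ∧ (tf) ∧ (rk) ∧ (hχ) ∧ (hL) ∧ (r5′) ∧ (KI)` of the input form from {a datum `D`, a gauge
  `(t′, m₀)`, the exposed divisibility (KI) `Φ.π ^ (m₀ + 2 * D.jα) ∣ D.cZ * t′`} + the print inputs; `inputsAt_of_facts_unitGauge`: at the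
  (C2) StarColumn gauge `Φ.t = 1` (p798933) the residual input is `Φ.π ^ (2 * D.jα) ∣ D.cZ` ALONE.
* §3 (GLOBAL) `inputsSevenR_of_reduced`: the REDUCED input form «★ → GZK → ∀ W ∈ 𝒞₇ ∀ (K,hK,γ,hγ,I) ∃ (F,θu) normed ∀ d ∃ Φ ∃ D :
  KatoExpDatum hγ Φ ∃ (t′,m₀), (ht′) ∧ (KI)» implies the FULL input form = v16 l.544–566 with `GenusSeven.DualExpValueDatum` ↦
  `GenusSeven.KatoExpDatum` and nothing else changed (= the letter g34's (KI)-R port 4/4 is announced to consume, pen D1019/D1021 (F):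
  binders verbatim; should 4/4's letter differ, §2 is the adapter), modulo the three print inputs {Hecke 1920, Rohrlich 1988, modularity}.

CONSEQUENCE FOR THE ROW (memo `K2C10RowClosure-g74.md` §0–§4).  The booked «(C4a) constructor» (g72 pin re-pinned over the repaired datum)
is NOT built here and should not be: (C4a) = `GenusSeven.RationalComparisonShape Φ` ((P3) l.118) is ALREADY proved from the input-form binders
by block (R) ★/★′/`rationalComparisonShape_of_inputs` (`Additive/RamifiedSevenRationalComparisonOfInputs.lean` l.92/l.245/l.266, p781873 +
part 2) and consumed by ★ (KI) `integralComparisonShape_of_inputs` (`…IntegralComparisonOfInputs.lean` l.81, p782137); its port over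
`KatoExpDatum` is g34's GO'd (C6-R) 3/4 (`…RationalComparisonOfInputsR.lean`, 290 l., 4 theorems, pen D1021 (F)).  What K2C-10 honestly
adds is THIS junction: after it, the (C4a)/(C4b) constructor's structural inputs are theorems and the research content of stub 2 is
exactly (F∃) frame-inhabitation + the datum (C6a/K2C-9) + (KI) (C4b) — numbers: 5 of the stub's 7 inner conjuncts discharged per frame;
sorry count of zp v16 UNCHANGED (4); named-fact cost of using §3 in a v17 restatement = +2 conjuncts of `stub_printFactsKato`
(`hecke1920_depletedHeckeL_entire`, `Rohrlich1988_nonvanishing_twists_anyLevel`; `exists_isNewformOf` is already conjunct 2) — the pen's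
FACT-LEDGER RULE D922 defers that join to the K2ᶜ-closing touch; this file forces nothing.

HONEST LABEL.  CONDITIONAL glue; every theorem is an implication from named print facts / GZK / a supplied datum; NOTHING is asserted about
inhabitation of `PinnedKatoGenusFrame` or `KatoExpDatum`; no stub of any registered line closes; stmt-BirchSwinnertonDyer-19945 OPEN (zp v16:
4 sorries); `X12.CMRamifiedSeven` NOT proved; no summit statement is proved by this seat; BSD is claimed for no curve.

References: K. Kato, Astérisque 295 (2004) Thm. 12.4 (2) (p. 221), 13.5 (p. 227), Prop. 15.9 (p. 258), 15.14 (p. 264), (15.16.1) (p. 265)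
[Kato2004Asterisque]; E. Hecke, Math. Z. 6 (1920) [Hecke1920]; D. Rohrlich, Invent. Math. 75 (1984) 409–423, Math. Ann. (1988)
[RohrlichInventiones1984]; C. Breuil, B. Conrad, F. Diamond, R. Taylor, JAMS 14 (2001) Thm. A [BreuilConradDiamondTaylor2001].
-/

noncomputable section

open scoped NumberField
open Field IsDedekindDomain NumberField
open Literature.NumberTheory.GaloisRepresentations
open Literature.NumberTheory.EllipticCurves
open Literature.NumberTheory.EllipticCurves.Rank1Residual
open Literature.NumberTheory.EllipticCurves.IwasawaAlgebra
open Literature.NumberTheory.EllipticCurves.Kato2004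
open Literature.NumberTheory.EllipticCurves.ModularForms
open Literature.NumberTheory.ComplexMultiplication.EllipticUnits
open Literature.NumberTheory.LFunctions
open Summit.BirchSwinnertonDyer.Rank1Residual
open Summit.BirchSwinnertonDyer.Rank1Residual.Additive
open Summit.BirchSwinnertonDyer.Rank1Residual.Additive.GenusSeven

namespace Summit.BirchSwinnertonDyer.BirchSwinnertonDyer.Cruxes.EllipticUnitValueSevenOfGZK.K2C10FactsJunction

/-! ## §1 The five structural / analytic conjuncts at one pinned frame — DATUM-FREE -/

section Frame

variable {W : WeierstrassCurve ℚ} [W.IsElliptic] [W.IsGloballyMinimal] [Fact (Nat.Prime 7)]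
  [ContinuousSMul ℤ_[7] (W.tateModule 7)] {K : ZpExtension ℚ 7} {hK : K.IsCyclotomic}
  {γ : Field.absoluteGaloisGroup ℚ} {I : IwasawaH1Data W 7 K γ}
  {F : GenusFrame} {θu : ∀ n : ℕ, globalUnitsOf (F.layer n)} {d : GenusDatum F θu}

/-- **(tf) ∧ (rk) ∧ (hχ) ∧ (hL) ∧ (r5′) at every pinned frame of a `𝒞₇` member**, conjunct letters = zp v16 l.551–565, from GZK,
`X12.ClassCSeven W`, the topological generator, Hecke 1920, Rohrlich 1988 and ONE newform of `W` (any level).  One term: the five landed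
discharges.  CONDITIONAL on the named facts; nothing asserted about frames; 19945 OPEN.
[cite: Kato2004Asterisque, Thm. 12.4 (2) (p. 221), 13.5 (p. 227), 15.14 (p. 264)] [cite: RohrlichInventiones1984, Theorem (p. 409)] -/
theorem structuralInputs_of_facts (hGZK : rank_eq_analyticRank_of_analyticRank_le_one) (hC : X12.ClassCSeven W)
    (hγ : K.IsTopGenerator γ) (hHecke : hecke1920_depletedHeckeL_entire)
    (hRo : Rohrlich1988_nonvanishing_twists_anyLevel) {N : ℕ} [NeZero N]
    {f : CuspForm (CongruenceSubgroup.Gamma0 N) 2} (hf : IsNewformOf W f)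
    (Φ : PinnedKatoGenusFrame W K hK I d) :
    (∀ (f : IwasawaAlgebra 7) (x : Φ.IK.H), f ≠ 0 → f • x = 0 → x = 0) ∧
    (∀ x y : Φ.IK.H, ∃ s r₀ r₁ : IwasawaAlgebra 7,
      (s ≠ 0 ∨ r₀ ≠ 0 ∨ r₁ ≠ 0) ∧ s • x = r₀ • y + r₁ • Φ.piK y) ∧
    (∀ n : ℕ, ∃ χ : Field.absoluteGaloisGroup Φ.Kcm →ₜ* ℂˣ,
      (∀ σ ∈ (K.restrictOfFinrankEqTwo (by decide) Φ.Kcm Φ.finrank_Kcm).layerSubgroup (n + 1), χ σ = 1) ∧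
        IsPrimitiveRoot (((χ Φ.γK : ℂˣ)) : ℂ) (7 ^ (n + 1))) ∧
    (∀ χ : Field.absoluteGaloisGroup Φ.Kcm →ₜ* ℂˣ, ∃ Lf : ℂ → ℂ, CM.IsDepletedHeckeL Φ.ψ χ (7 * (7 * F.d)) Lf) ∧
    (∃ n₁ : ℕ, ∀ n : ℕ, n₁ ≤ n → ∀ χ : Field.absoluteGaloisGroup Φ.Kcm →ₜ* ℂˣ,
      (∀ σ ∈ (K.restrictOfFinrankEqTwo (by decide) Φ.Kcm Φ.finrank_Kcm).layerSubgroup (n + 1), χ σ = 1) →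
      IsPrimitiveRoot (((χ Φ.γK : ℂˣ)) : ℂ) (7 ^ (n + 1)) →
      ∀ Lf : ℂ → ℂ, CM.IsDepletedHeckeL Φ.ψ χ (7 * (7 * F.d)) Lf → Lf 1 ≠ 0) :=
  ⟨Φ.tf_of_inputs hγ, Φ.rk_of_inputs hGZK hC hγ, Φ.hχ_of_inputs, Φ.hL_of_inputs hHecke, Φ.r5'_of_facts hRo hC hf⟩

/-- **The same from the tree's MODULARITY fact** `ModularForms.exists_isNewformOf` (conjunct 2 of zp's `stub_printFactsKato`): the
newform is taken at level `N_W = W.conductorNorm ℤ` (`NeZero` by `conductorNorm_pos_holds`).  CONDITIONAL; 19945 OPEN.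
[cite: BreuilConradDiamondTaylor2001, Thm. A] [cite: Kato2004Asterisque, Thm. 12.4 (2) (p. 221), 13.5 (p. 227)] -/
theorem structuralInputs_of_mod (hGZK : rank_eq_analyticRank_of_analyticRank_le_one) (hC : X12.ClassCSeven W)
    (hγ : K.IsTopGenerator γ) (hHecke : hecke1920_depletedHeckeL_entire)
    (hRo : Rohrlich1988_nonvanishing_twists_anyLevel) (hmod : ModularForms.exists_isNewformOf)
    (Φ : PinnedKatoGenusFrame W K hK I d) :
    (∀ (f : IwasawaAlgebra 7) (x : Φ.IK.H), f ≠ 0 → f • x = 0 → x = 0) ∧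
    (∀ x y : Φ.IK.H, ∃ s r₀ r₁ : IwasawaAlgebra 7,
      (s ≠ 0 ∨ r₀ ≠ 0 ∨ r₁ ≠ 0) ∧ s • x = r₀ • y + r₁ • Φ.piK y) ∧
    (∀ n : ℕ, ∃ χ : Field.absoluteGaloisGroup Φ.Kcm →ₜ* ℂˣ,
      (∀ σ ∈ (K.restrictOfFinrankEqTwo (by decide) Φ.Kcm Φ.finrank_Kcm).layerSubgroup (n + 1), χ σ = 1) ∧
        IsPrimitiveRoot (((χ Φ.γK : ℂˣ)) : ℂ) (7 ^ (n + 1))) ∧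
    (∀ χ : Field.absoluteGaloisGroup Φ.Kcm →ₜ* ℂˣ, ∃ Lf : ℂ → ℂ, CM.IsDepletedHeckeL Φ.ψ χ (7 * (7 * F.d)) Lf) ∧
    (∃ n₁ : ℕ, ∀ n : ℕ, n₁ ≤ n → ∀ χ : Field.absoluteGaloisGroup Φ.Kcm →ₜ* ℂˣ,
      (∀ σ ∈ (K.restrictOfFinrankEqTwo (by decide) Φ.Kcm Φ.finrank_Kcm).layerSubgroup (n + 1), χ σ = 1) →
      IsPrimitiveRoot (((χ Φ.γK : ℂˣ)) : ℂ) (7 ^ (n + 1)) →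
      ∀ Lf : ℂ → ℂ, CM.IsDepletedHeckeL Φ.ψ χ (7 * (7 * F.d)) Lf → Lf 1 ≠ 0) := by
  haveI : NeZero (W.conductorNorm ℤ) := ⟨(W.conductorNorm_pos_holds).ne'⟩
  obtain ⟨f, hf⟩ := hmod W
  exact structuralInputs_of_facts hGZK hC hγ hHecke hRo hf Φ

/-! ## §2 The whole per-frame body of the input form over the repaired datum `KatoExpDatum` ((C6-R) 2/4, p800949) -/

/-- **Per-frame input-form body from {datum, gauge, (KI)} + print inputs** — the seven inner conjuncts of zp v16 l.550–566 with
`GenusSeven.DualExpValueDatum` ↦ `GenusSeven.KatoExpDatum` (the repaired, inhabitable currency: layer-indexed `n ↦ L_{7𝔣}(ψ̄λ_{χ_n},1)/Ω(γ₀)`).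
The only non-print inputs left at a frame are a datum `D`, a gauge `(t′, m₀)` and the exposed divisibility (KI).  CONDITIONAL; 19945 OPEN.
[cite: Kato2004Asterisque, Prop. 15.9 (p. 258), (15.16.1) (p. 265), Thm. 12.4 (2) (p. 221), 13.5 (p. 227)] -/
theorem inputsAt_of_facts (hGZK : rank_eq_analyticRank_of_analyticRank_le_one) (hC : X12.ClassCSeven W)
    (hγ : K.IsTopGenerator γ) (hHecke : hecke1920_depletedHeckeL_entire)
    (hRo : Rohrlich1988_nonvanishing_twists_anyLevel) {N : ℕ} [NeZero N]
    {f : CuspForm (CongruenceSubgroup.Gamma0 N) 2} (hf : IsNewformOf W f)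
    (Φ : PinnedKatoGenusFrame W K hK I d) (D : KatoExpDatum hγ Φ) (t' : Φ.R) (m₀ : ℕ)
    (ht : Φ.t * t' = Φ.π ^ m₀) (hKI : Φ.π ^ (m₀ + 2 * D.jα) ∣ D.cZ * t') :
    ∃ D : KatoExpDatum hγ Φ, ∃ (t' : Φ.R) (m₀ : ℕ), Φ.t * t' = Φ.π ^ m₀ ∧
      (∀ (f : IwasawaAlgebra 7) (x : Φ.IK.H), f ≠ 0 → f • x = 0 → x = 0) ∧
      (∀ x y : Φ.IK.H, ∃ s r₀ r₁ : IwasawaAlgebra 7,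
        (s ≠ 0 ∨ r₀ ≠ 0 ∨ r₁ ≠ 0) ∧ s • x = r₀ • y + r₁ • Φ.piK y) ∧
      (∀ n : ℕ, ∃ χ : Field.absoluteGaloisGroup Φ.Kcm →ₜ* ℂˣ,
        (∀ σ ∈ (K.restrictOfFinrankEqTwo (by decide) Φ.Kcm Φ.finrank_Kcm).layerSubgroup (n + 1), χ σ = 1) ∧
          IsPrimitiveRoot (((χ Φ.γK : ℂˣ)) : ℂ) (7 ^ (n + 1))) ∧
      (∀ χ : Field.absoluteGaloisGroup Φ.Kcm →ₜ* ℂˣ, ∃ Lf : ℂ → ℂ, CM.IsDepletedHeckeL Φ.ψ χ (7 * (7 * F.d)) Lf) ∧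
      (∃ n₁ : ℕ, ∀ n : ℕ, n₁ ≤ n → ∀ χ : Field.absoluteGaloisGroup Φ.Kcm →ₜ* ℂˣ,
        (∀ σ ∈ (K.restrictOfFinrankEqTwo (by decide) Φ.Kcm Φ.finrank_Kcm).layerSubgroup (n + 1), χ σ = 1) →
        IsPrimitiveRoot (((χ Φ.γK : ℂˣ)) : ℂ) (7 ^ (n + 1)) →
        ∀ Lf : ℂ → ℂ, CM.IsDepletedHeckeL Φ.ψ χ (7 * (7 * F.d)) Lf → Lf 1 ≠ 0) ∧
      Φ.π ^ (m₀ + 2 * D.jα) ∣ D.cZ * t' := by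
  obtain ⟨htf, hrk, hχ, hL, hRoh⟩ := structuralInputs_of_facts hGZK hC hγ hHecke hRo hf Φ
  exact ⟨D, t', m₀, ht, htf, hrk, hχ, hL, hRoh, hKI⟩

/-- **At the unit gauge** `Φ.t = 1` (the (C2) StarColumn choice `t := 1`, `Additive/RamifiedSevenGenusStarColumn.lean` p798933; `t′ := 1`,
`m₀ := 0`): the ONLY non-print per-frame inputs are the datum and `Φ.π ^ (2 * D.jα) ∣ D.cZ` — (KI) `v_𝔭(α₀² + 7α₁²)`-many `π`'s divide
`(α₀ − α₁π)·7^e·zStar-unit⁻¹·…` (falsifier (F-b) of `Cruxes/…/FbPreregistration-g65.md`, unchanged).  CONDITIONAL; 19945 OPEN.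
[cite: Kato2004Asterisque, (15.16.1) (p. 265), 15.14 (p. 264)] -/
theorem inputsAt_of_facts_unitGauge (hGZK : rank_eq_analyticRank_of_analyticRank_le_one) (hC : X12.ClassCSeven W)
    (hγ : K.IsTopGenerator γ) (hHecke : hecke1920_depletedHeckeL_entire)
    (hRo : Rohrlich1988_nonvanishing_twists_anyLevel) {N : ℕ} [NeZero N]
    {f : CuspForm (CongruenceSubgroup.Gamma0 N) 2} (hf : IsNewformOf W f)
    (Φ : PinnedKatoGenusFrame W K hK I d) (ht1 : Φ.t = 1) (D : KatoExpDatum hγ Φ)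
    (hKI : Φ.π ^ (2 * D.jα) ∣ D.cZ) :
    ∃ D : KatoExpDatum hγ Φ, ∃ (t' : Φ.R) (m₀ : ℕ), Φ.t * t' = Φ.π ^ m₀ ∧
      (∀ (f : IwasawaAlgebra 7) (x : Φ.IK.H), f ≠ 0 → f • x = 0 → x = 0) ∧
      (∀ x y : Φ.IK.H, ∃ s r₀ r₁ : IwasawaAlgebra 7,
        (s ≠ 0 ∨ r₀ ≠ 0 ∨ r₁ ≠ 0) ∧ s • x = r₀ • y + r₁ • Φ.piK y) ∧
      (∀ n : ℕ, ∃ χ : Field.absoluteGaloisGroup Φ.Kcm →ₜ* ℂˣ,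
        (∀ σ ∈ (K.restrictOfFinrankEqTwo (by decide) Φ.Kcm Φ.finrank_Kcm).layerSubgroup (n + 1), χ σ = 1) ∧
          IsPrimitiveRoot (((χ Φ.γK : ℂˣ)) : ℂ) (7 ^ (n + 1))) ∧
      (∀ χ : Field.absoluteGaloisGroup Φ.Kcm →ₜ* ℂˣ, ∃ Lf : ℂ → ℂ, CM.IsDepletedHeckeL Φ.ψ χ (7 * (7 * F.d)) Lf) ∧
      (∃ n₁ : ℕ, ∀ n : ℕ, n₁ ≤ n → ∀ χ : Field.absoluteGaloisGroup Φ.Kcm →ₜ* ℂˣ,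
        (∀ σ ∈ (K.restrictOfFinrankEqTwo (by decide) Φ.Kcm Φ.finrank_Kcm).layerSubgroup (n + 1), χ σ = 1) →
        IsPrimitiveRoot (((χ Φ.γK : ℂˣ)) : ℂ) (7 ^ (n + 1)) →
        ∀ Lf : ℂ → ℂ, CM.IsDepletedHeckeL Φ.ψ χ (7 * (7 * F.d)) Lf → Lf 1 ≠ 0) ∧
      Φ.π ^ (m₀ + 2 * D.jα) ∣ D.cZ * t' :=
  inputsAt_of_facts hGZK hC hγ hHecke hRo hf Φ D 1 0 (by rw [ht1, one_mul, pow_zero])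
    (by simpa only [zero_add, mul_one] using hKI)

end Frame

/-! ## §3 GLOBAL: the reduced input form implies the full input form (v16 letter, datum ↦ `KatoExpDatum`) -/

/-- **REDUCED ⇒ FULL INPUT FORM.**  Hypothesis `h` = zp v16's `stub_integralComparisonInputsSeven` (l.544–566) with
`GenusSeven.DualExpValueDatum` ↦ `GenusSeven.KatoExpDatum` and the five conjuncts (tf) (rk) (hχ) (hL) (r5′) STRUCK; conclusion = the same
letter with the five conjuncts RESTORED — the input the (KI)-R assembly `integralComparisonSeven_of_inputs` (port 4/4 of (C6-R), announced
binders-verbatim) consumes.  Print inputs: Hecke 1920, Rohrlich 1988, modularity (`exists_isNewformOf`).  CONDITIONAL; nothing asserted; no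
stub closes; 19945 OPEN; no summit statement is proved.
[cite: Kato2004Asterisque, Thm. 12.4 (2) (p. 221), 13.5 (p. 227), Prop. 15.9 (p. 258), 15.14 (p. 264), (15.16.1) (p. 265)]
[cite: RohrlichInventiones1984, Theorem (p. 409)] [cite: BreuilConradDiamondTaylor2001, Thm. A] -/
theorem inputsSevenR_of_reduced (hHecke : hecke1920_depletedHeckeL_entire) (hRo : Rohrlich1988_nonvanishing_twists_anyLevel)
    (hmod : ModularForms.exists_isNewformOf)
    (h : Kato2004.exists_zetaClassPosition_of_rank_le_one → rank_eq_analyticRank_of_analyticRank_le_one →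
      ∀ (W : WeierstrassCurve ℚ) [W.IsElliptic] [W.IsGloballyMinimal] [Fact (Nat.Prime 7)], X12.ClassCSeven W →
      letI : ContinuousSMul ℤ_[7] (W.tateModule 7) := TateModule.continuousSMul_padicInt
      ∀ (K : ZpExtension ℚ 7) (hK : K.IsCyclotomic) (γ : Field.absoluteGaloisGroup ℚ) (hγ : K.IsTopGenerator γ)
        (I : IwasawaH1Data W 7 K γ),
        ∃ (F : GenusSeven.GenusFrame) (θu : ∀ n : ℕ, globalUnitsOf (F.layer n)), GenusSeven.IsNormedEllipticUnitFamily F θu ∧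
          ∀ d : GenusSeven.GenusDatum F θu, ∃ Φ : GenusSeven.PinnedKatoGenusFrame W K hK I d, ∃ D : GenusSeven.KatoExpDatum hγ Φ,
            ∃ (t' : Φ.R) (m₀ : ℕ), Φ.t * t' = Φ.π ^ m₀ ∧ Φ.π ^ (m₀ + 2 * D.jα) ∣ D.cZ * t') :
    Kato2004.exists_zetaClassPosition_of_rank_le_one → rank_eq_analyticRank_of_analyticRank_le_one →
      ∀ (W : WeierstrassCurve ℚ) [W.IsElliptic] [W.IsGloballyMinimal] [Fact (Nat.Prime 7)], X12.ClassCSeven W →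
      letI : ContinuousSMul ℤ_[7] (W.tateModule 7) := TateModule.continuousSMul_padicInt
      ∀ (K : ZpExtension ℚ 7) (hK : K.IsCyclotomic) (γ : Field.absoluteGaloisGroup ℚ) (hγ : K.IsTopGenerator γ)
        (I : IwasawaH1Data W 7 K γ),
        ∃ (F : GenusSeven.GenusFrame) (θu : ∀ n : ℕ, globalUnitsOf (F.layer n)), GenusSeven.IsNormedEllipticUnitFamily F θu ∧
          ∀ d : GenusSeven.GenusDatum F θu, ∃ Φ : GenusSeven.PinnedKatoGenusFrame W K hK I d, ∃ D : GenusSeven.KatoExpDatum hγ Φ,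
            ∃ (t' : Φ.R) (m₀ : ℕ), Φ.t * t' = Φ.π ^ m₀ ∧
            (∀ (f : IwasawaAlgebra 7) (x : Φ.IK.H), f ≠ 0 → f • x = 0 → x = 0) ∧
            (∀ x y : Φ.IK.H, ∃ s r₀ r₁ : IwasawaAlgebra 7,
              (s ≠ 0 ∨ r₀ ≠ 0 ∨ r₁ ≠ 0) ∧ s • x = r₀ • y + r₁ • Φ.piK y) ∧
            (∀ n : ℕ, ∃ χ : Field.absoluteGaloisGroup Φ.Kcm →ₜ* ℂˣ,
              (∀ σ ∈ (K.restrictOfFinrankEqTwo (by decide) Φ.Kcm Φ.finrank_Kcm).layerSubgroup (n + 1), χ σ = 1) ∧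
                IsPrimitiveRoot (((χ Φ.γK : ℂˣ)) : ℂ) (7 ^ (n + 1))) ∧
            (∀ χ : Field.absoluteGaloisGroup Φ.Kcm →ₜ* ℂˣ, ∃ Lf : ℂ → ℂ, CM.IsDepletedHeckeL Φ.ψ χ (7 * (7 * F.d)) Lf) ∧
            (∃ n₁ : ℕ, ∀ n : ℕ, n₁ ≤ n → ∀ χ : Field.absoluteGaloisGroup Φ.Kcm →ₜ* ℂˣ,
              (∀ σ ∈ (K.restrictOfFinrankEqTwo (by decide) Φ.Kcm Φ.finrank_Kcm).layerSubgroup (n + 1), χ σ = 1) →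
              IsPrimitiveRoot (((χ Φ.γK : ℂˣ)) : ℂ) (7 ^ (n + 1)) →
              ∀ Lf : ℂ → ℂ, CM.IsDepletedHeckeL Φ.ψ χ (7 * (7 * F.d)) Lf → Lf 1 ≠ 0) ∧
            Φ.π ^ (m₀ + 2 * D.jα) ∣ D.cZ * t' := by
  intro hstar hGZK W _ _ _ hC K hK γ hγ I
  haveI : ContinuousSMul ℤ_[7] (W.tateModule 7) := TateModule.continuousSMul_padicInt
  haveI : NeZero (W.conductorNorm ℤ) := ⟨(W.conductorNorm_pos_holds).ne'⟩
  obtain ⟨f, hf⟩ := hmod W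
  obtain ⟨F, θu, hpin, hΦ⟩ := h hstar hGZK W hC K hK γ hγ I
  refine ⟨F, θu, hpin, fun d => ?_⟩
  obtain ⟨Φ, D, t', m₀, ht, hKI⟩ := hΦ d
  exact ⟨Φ, inputsAt_of_facts hGZK hC hγ hHecke hRo hf Φ D t' m₀ ht hKI⟩

end Summit.BirchSwinnertonDyer.BirchSwinnertonDyer.Cruxes.EllipticUnitValueSevenOfGZK.K2C10FactsJunction

end
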